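import Summits.HubbardSuperconductivity.HubbardSuperconductivity.Theorems.KLProgrammeKLRegimeFlowReadScaleZeroSunsetCertRowsTwoShellsSup
import Summits.HubbardSuperconductivity.HubbardSuperconductivity.Theorems.KLProgrammeKLRegimeScaleZeroCovarianceFarL2ImagesEngine

/-!
# Route `KLProgramme`, crux K3 — engine-flow child (stmt-HubbardSuperconductivity-20437), stub (C) at `n = 0`, located item #22a «(C)-SCALE0-PT2»:
# THE CERTIFIED SUNSET ROWS FROM THE NEAR CERTIFICATE AND TWO PARSEVAL-GAP NUMBERS — one call for the (C) closer

Cell gate-hubbard-kl, seat p1 g22.  Composition, by name, of the far-half closer of record `…SunsetCertRowsTwoShellsSup.sunsetRows_of_certV3_twoShellsSup`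
with the low-shell readers `…FarL2ImagesLowShell.farLattice_bare_zero/two_le_of_gap`, `…_one_le_of_gaps` and `…FarL2ImagesEngine.l2Far_low_envelope_of_farLattice_klEng`:
the low-shell input shrinks to TWO NUMBERS `G₀, G₂` bounding, at every Matsubara frequency `|ω_i| < ω₁` of the μ at hand, the Parseval GAPS
`∫_{[0,1)²}‖g_ω‖² − Σ_{z ∈ {0} ∪ disk}‖a_ω(z)‖² ≤ G₀` and `(2π)⁻²Σ_j∫_{[0,1)²}‖Dg_ω[e_j]‖² − Σ_{z ∈ {0} ∪ disk}(z₀²+z₁²)‖a_ω(z)‖² ≤ G₂`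
(`g_ω(y) = Ψ¹(ω, e₀(2πy))`, `a_ω(z) = 𝓕(g_ω♭)(−z)`; this is what the k3c5 lineage's low-shell cert predicate / kit job B delivers, per μ-cell), and the rows read
**`Dlow k := (√(G_k) + 10⁻¹⁰)²`, `G₁ := √(G₀·G₂)`**:
* **`sunsetRows_of_certV3_plancherelGaps`** — hypotheses: the near cert `ScaleZeroSunsetCertV3 c` with its reader's side conditions (as in p646292 / the twin),
  the engine thresholds `klBetaMin ≤ β`, `0 < U ≤ 2⁻²⁰`, `klEngL₃ β U ≤ L` (images term `≤ 10⁻¹⁰`), the crossover `klE0 ≤ ω₁` with `e^{−κ₁L/2} ≤ 1/2` and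
  `√(16+ω₁²) ≤ (Rc+1)ω₁`, the two gap families, and `bS k ≥ row k + S_far·(2ᵏ·2500·C(ω₁,Rc)/ω₁ + ω₁·Dlow k)` with `S_far = 50e^{−κ₁(Rc+1)} + ω₁·(√G₀ + 10⁻¹⁰)`;
  conclusion: the `hS0`/`hSk` of `twoLegRead_frameZero_of_sunsetData`, literally;
* §2 (append) `sqrt_sixteen_add_sq_le_of_klE0_le` (`128 ≤ Rc` ⇒ the side hypothesis), `exp_neg_arsinh_mul_le_half_of_le` (`2¹⁰ ≤ L` ⇒ the strip
  door's `L`-condition), and **`sunsetRows_of_certV3_plancherelGaps'`** — the same call with both discharged (`128 ≤ c.Rc`; `klEngL₃ ≥ 2¹⁰`).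

No definitions; nothing here asserts (C), any stub of 20437, K3 or superconductivity; the near certificate and the gaps are HYPOTHESES certified numerically by the kit.
References: BGM 2006 §2.2–§2.3, §3 (3.2) [cite: BenfattoGiulianiMastropietro2006].
-/

noncomputable section

namespace Summit.HubbardSuperconductivity.HubbardSuperconductivity.Theorems.KLRegimeSplit

set_option linter.dupNamespace false -- summit = problem name (single-conjunct summit), D-0017

open Literature.MathematicalPhysics.QuantumLattice Literature.Probability.LatticeModels Literature.Analysis.FunctionSpaces
open Summit.HubbardSuperconductivity.HubbardSuperconductivity.Theorems.DispersionFlow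
open Summit.HubbardSuperconductivity.HubbardSuperconductivity.Theorems.EngineV8
open MeasureTheory Set Finset Complex UnitAddTorus Real GrassmannAlgebra Matrix
open scoped FourierTransform Nat ENNReal NNReal

variable {L M : ℕ} [NeZero L]

/-- **THE CERTIFIED SUNSET ROWS FROM THE NEAR CERTIFICATE AND TWO PARSEVAL-GAP NUMBERS** (bare frame; #22a far half of record (R228) composed with the
low-shell readers; `Dlow k = (√G_k + 10⁻¹⁰)²`, `G₁ = √(G₀G₂)`). -/
theorem sunsetRows_of_certV3_plancherelGaps [NeZero M] (c : SunsetCellRecordV3) (hc : ScaleZeroSunsetCertV3 c)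
    {μ β U : ℝ} (hμlo : (c.μlo : ℝ) ≤ μ) (hμhi : μ ≤ c.μhi)
    (hβ : klBetaMin ≤ β) (hU0 : 0 < U) (hU : U ≤ (2 : ℝ)⁻¹ ^ 20) (hL3 : klEngL₃ β U ≤ L)
    (hδ : β / ((2 * (2 * M) : ℕ) : ℝ) ≤ (2 : ℝ)⁻¹ ^ 10)
    {N' R : ℕ} (hN' : 2 * 2 ≤ N') (hR : R + 1 + 2 * c.Rc ≤ L)
    (hT : ENNReal.ofReal (β / klBetaMin) *
        ENNReal.ofReal ((19 / 3) * (4 + |μ| + (0 : TrigPolyC4v).coeffNorm 0) * β / (2 * π ^ 2 * M) +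
            (N' ! * klChi2CauchyTab N' * (N' + 1) ! * 4 * (max 1 (4 / klE0)) ^ (N' - 1) * ((2 * π) * 4) ^ N') * (2 / klE0) *
              (1 / (2 * Real.pi) ^ N' * (2 / ((2 * R + 2 : ℕ) : ℝ)) ^ (N' - 2 * 2) * (2 ^ 2 * ∑' k : Site 2, ∏ j, (1 + (k j : ℝ) ^ 2)⁻¹))) ≤
      ENNReal.ofReal (c.Tmax : ℝ))
    (hrow : ∀ k : Fin 3, 0 ≤ (c.row k : ℝ))
    {ω₁ : ℝ} (hω₁ : klE0 ≤ ω₁) (hρ : Real.exp (-(Real.arsinh (ω₁ / 4) * L / 2)) ≤ 1 / 2)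
    (hR' : Real.sqrt (16 + ω₁ ^ 2) ≤ ((c.Rc : ℝ) + 1) * ω₁)
    {G₀ G₂ : ℝ}
    (hgap0 : ∀ i : MatsubaraIdx M, |matsubaraFreq β M i| < ω₁ →
      (∫ y in Torus.unitCube (Fin 2), ‖(fun y : Momentum => uvSymbolFn 1 klE0 (frameLevel μ 0 ((2 * π) • y)) (matsubaraFreq β M i)) y‖ ^ 2) -
        ∑ z ∈ insert (0 : Site 2) c.disk, ‖mFourierCoeff (Torus.descend
          (fun y : Momentum => uvSymbolFn 1 klE0 (frameLevel μ 0 ((2 * π) • y)) (matsubaraFreq β M i))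
          (uvSpatialSymbol_isLatticePeriodic 1 klE0 μ 0 (matsubaraFreq β M i))) (-z)‖ ^ 2 ≤ G₀)
    (hgap2 : ∀ i : MatsubaraIdx M, |matsubaraFreq β M i| < ω₁ →
      (2 * π) ^ (-(2 : ℤ)) *
        ((∫ y in Torus.unitCube (Fin 2), ‖fderiv ℝ (fun y : Momentum => uvSymbolFn 1 klE0 (frameLevel μ 0 ((2 * π) • y)) (matsubaraFreq β M i)) y
            (EuclideanSpace.single 0 (1 : ℝ))‖ ^ 2) +
          ∫ y in Torus.unitCube (Fin 2), ‖fderiv ℝ (fun y : Momentum => uvSymbolFn 1 klE0 (frameLevel μ 0 ((2 * π) • y)) (matsubaraFreq β M i)) y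
            (EuclideanSpace.single 1 (1 : ℝ))‖ ^ 2) -
        ∑ z ∈ insert (0 : Site 2) c.disk, ((((z 0 : ℤ) : ℝ)) ^ 2 + (((z 1 : ℤ) : ℝ)) ^ 2) *
          ‖mFourierCoeff (Torus.descend (fun y : Momentum => uvSymbolFn 1 klE0 (frameLevel μ 0 ((2 * π) • y)) (matsubaraFreq β M i))
            (uvSpatialSymbol_isLatticePeriodic 1 klE0 μ 0 (matsubaraFreq β M i))) (-z)‖ ^ 2 ≤ G₂)
    {bS : ℕ → ℝ}
    (hbS : ∀ k : Fin 3, (c.row k : ℝ) +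
      (50 * Real.exp (-(Real.arsinh (ω₁ / 4) * (c.Rc + 1))) + ω₁ * Real.sqrt ((Real.sqrt (![G₀, Real.sqrt (G₀ * G₂), G₂] 0) + (10 : ℝ)⁻¹ ^ 10) ^ 2)) *
        (2 ^ (k : ℕ) * 2500 *
          ((max 1 ((2 * (k : ℕ) : ℝ) / Real.arsinh (ω₁ / 4))) ^ (k : ℕ) * Real.exp (-(Real.arsinh (ω₁ / 4) * (c.Rc + 1))) *
            (1 + 2 * (1 - Real.exp (-(Real.arsinh (ω₁ / 4) / 4)))⁻¹) ^ 2) / ω₁ +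
          ω₁ * (Real.sqrt (![G₀, Real.sqrt (G₀ * G₂), G₂] k) + (10 : ℝ)⁻¹ ^ 10) ^ 2) ≤ bS k) :
    (∀ (σ : Fin 2) (p₀ : GridPoint L (2 * (2 * M))), ∑ p₁ : GridPoint L (2 * (2 * M)),
      (if p₁ = p₀ then (0 : ℝ) else (if p₁.2 - p₀.2 = 0 then (0 : ℝ) else 1) * ‖contr ℂ ((hubbardGridSub L M β (2 * (2 * M))).transpose * hubbardCovAboveCT L M β μ 0 0 klE0 *
                hubbardGridSub L M β (2 * (2 * M))) (((p₁, σ), 0) : GridLeg (GridPoint L (2 * (2 * M)))) ((p₀, σ), 1) *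
              (contr ℂ ((hubbardGridSub L M β (2 * (2 * M))).transpose * hubbardCovAboveCT L M β μ 0 0 klE0 *
                hubbardGridSub L M β (2 * (2 * M))) (((p₀, σ.rev), 0) : GridLeg (GridPoint L (2 * (2 * M)))) ((p₁, σ.rev), 1) *
                contr ℂ ((hubbardGridSub L M β (2 * (2 * M))).transpose * hubbardCovAboveCT L M β μ 0 0 klE0 *
                hubbardGridSub L M β (2 * (2 * M))) (((p₁, σ.rev), 0) : GridLeg (GridPoint L (2 * (2 * M)))) ((p₀, σ.rev), 1))‖) ≤ bS 0 * (((2 * (2 * M) : ℕ) : ℝ) / β)) ∧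
    (∀ k, 1 ≤ k → k ≤ 2 → ∀ (σ : Fin 2) (p₀ : GridPoint L (2 * (2 * M))), ∑ p₁ : GridPoint L (2 * (2 * M)),
      (if p₁ = p₀ then (0 : ℝ) else
        Real.sqrt ((((p₁.2 - p₀.2) 0).valMinAbs.natAbs : ℝ) ^ 2 + (((p₁.2 - p₀.2) 1).valMinAbs.natAbs : ℝ) ^ 2) ^ k * ‖contr ℂ ((hubbardGridSub L M β (2 * (2 * M))).transpose * hubbardCovAboveCT L M β μ 0 0 klE0 *
                hubbardGridSub L M β (2 * (2 * M))) (((p₁, σ), 0) : GridLeg (GridPoint L (2 * (2 * M)))) ((p₀, σ), 1) *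
              (contr ℂ ((hubbardGridSub L M β (2 * (2 * M))).transpose * hubbardCovAboveCT L M β μ 0 0 klE0 *
                hubbardGridSub L M β (2 * (2 * M))) (((p₀, σ.rev), 0) : GridLeg (GridPoint L (2 * (2 * M)))) ((p₁, σ.rev), 1) *
                contr ℂ ((hubbardGridSub L M β (2 * (2 * M))).transpose * hubbardCovAboveCT L M β μ 0 0 klE0 *
                hubbardGridSub L M β (2 * (2 * M))) (((p₁, σ.rev), 0) : GridLeg (GridPoint L (2 * (2 * M)))) ((p₀, σ.rev), 1))‖) ≤
        bS k * (((2 * (2 * M) : ℕ) : ℝ) / β)) := by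
  have hβ₀ : (0 : ℝ) < klBetaMin := by norm_num [klBetaMin]
  have hβpos : 0 < β := lt_of_lt_of_le hβ₀ hβ
  -- the three far lattice sums from the two gaps
  set D : Fin 3 → ℝ := ![G₀, Real.sqrt (G₀ * G₂), G₂] with hDdef
  have hD : ∀ (k : Fin 3) (i : MatsubaraIdx M), |matsubaraFreq β M i| < ω₁ →
      ∑' z : Site 2, (if z ≠ 0 ∧ z ∉ c.disk then Real.sqrt ((((z 0 : ℤ) : ℝ)) ^ 2 + (((z 1 : ℤ) : ℝ)) ^ 2) ^ (k : ℕ) else 0) *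
        ‖mFourierCoeff (Torus.descend (fun y : Momentum => uvSymbolFn 1 klE0 (frameLevel μ 0 ((2 * π) • y)) (matsubaraFreq β M i))
          (uvSpatialSymbol_isLatticePeriodic 1 klE0 μ 0 (matsubaraFreq β M i))) (-z)‖ ^ 2 ≤ D k := by
    intro k i hi
    have hne : matsubaraFreq β M i ≠ 0 := matsubaraFreq_ne_zero' hβpos i
    fin_cases k
    · exact farLattice_bare_zero_le_of_gap μ c.toSunsetCellRecordV2 hne (hgap0 i hi)
    · exact farLattice_bare_one_le_of_gaps μ c.toSunsetCellRecordV2 hne (hgap0 i hi) (hgap2 i hi)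
    · exact farLattice_bare_two_le_of_gap μ c.toSunsetCellRecordV2 hne (hgap2 i hi)
  -- the low-shell envelope under the engine thresholds
  have hlow := l2Far_low_envelope_of_farLattice_klEng (L := L) μ hβ hU0 hU hL3 ω₁ c.toSunsetCellRecordV2 hD
  exact sunsetRows_of_certV3_twoShellsSup (L := L) c hc hμlo hμhi hβ hδ hN' hR hT hrow hω₁ hρ hR'
    (Dlow := fun k => (Real.sqrt (D k) + (10 : ℝ)⁻¹ ^ 10) ^ 2) (fun k => sq_nonneg _) hlow hbS


/-! ## §2 (append) The two elementary side conditions discharged, and the glue without them -/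

omit [NeZero L] in
/-- **`√(16 + ω₁²) ≤ (Rc+1)·ω₁`** for `klE0 ≤ ω₁` and `128 ≤ Rc` (`16 ≤ 16640·ω₁²` at `ω₁ ≥ 1/32`). -/
theorem sqrt_sixteen_add_sq_le_of_klE0_le {ω₁ : ℝ} (hω₁ : klE0 ≤ ω₁) {Rc : ℕ} (hRc : 128 ≤ Rc) :
    Real.sqrt (16 + ω₁ ^ 2) ≤ ((Rc : ℝ) + 1) * ω₁ := by
  have hE0 : ω₁ ≥ 1 / 32 := by have : klE0 = 1 / 32 := rfl; rw [← this]; exact hω₁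
  have hω0 : 0 < ω₁ := by linarith
  have hRc0 : (128 : ℝ) ≤ Rc := by exact_mod_cast hRc
  have hRc' : (129 : ℝ) ≤ (Rc : ℝ) + 1 := by linarith
  have h1 : Real.sqrt (16 + ω₁ ^ 2) ≤ 129 * ω₁ := by
    rw [show (129 : ℝ) * ω₁ = Real.sqrt ((129 * ω₁) ^ 2) by rw [Real.sqrt_sq (by positivity)]]
    refine Real.sqrt_le_sqrt ?_
    nlinarith
  exact h1.trans (mul_le_mul_of_nonneg_right hRc' hω0.le)

omit [NeZero L] in
/-- **`e^{−arsinh(ω₁/4)·L/2} ≤ 1/2`** for `klE0 ≤ ω₁` and `2¹⁰ ≤ L` (`arsinh x ≥ log(1+x) ≥ 1 − 1/(1+x)`, so `κ₁ ≥ 1/129`, `κ₁L/2 ≥ 1`, `e⁻¹ ≤ 1/2`). -/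
theorem exp_neg_arsinh_mul_le_half_of_le {ω₁ : ℝ} (hω₁ : klE0 ≤ ω₁) (hL : 2 ^ 10 ≤ L) :
    Real.exp (-(Real.arsinh (ω₁ / 4) * L / 2)) ≤ 1 / 2 := by
  have hE0 : ω₁ ≥ 1 / 32 := by have : klE0 = 1 / 32 := rfl; rw [← this]; exact hω₁
  have hω0 : 0 < ω₁ := by linarith
  have hLr : (1024 : ℝ) ≤ L := by exact_mod_cast hL
  -- `arsinh(ω₁/4) ≥ arsinh(1/128) ≥ log(1 + 1/128) ≥ 1 − 1/(1+1/128) = 1/129`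
  have hκ : (1 : ℝ) / 129 ≤ Real.arsinh (ω₁ / 4) := by
    have hmono : Real.arsinh (1 / 128) ≤ Real.arsinh (ω₁ / 4) := Real.arsinh_le_arsinh.2 (by linarith)
    refine le_trans ?_ hmono
    rw [Real.arsinh]
    have hs : (1 : ℝ) ≤ Real.sqrt (1 + (1 / 128) ^ 2) := by
      rw [show (1 : ℝ) = Real.sqrt 1 by rw [Real.sqrt_one]]
      exact Real.sqrt_le_sqrt (by norm_num)
    have hpos : (0 : ℝ) < 1 / 128 + Real.sqrt (1 + (1 / 128) ^ 2) := by positivity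
    have hlog := Real.one_sub_inv_le_log_of_pos hpos
    refine le_trans ?_ hlog
    have h2 : (1 + 1 / 128 : ℝ) ≤ 1 / 128 + Real.sqrt (1 + (1 / 128) ^ 2) := by linarith
    have h3 : (1 / 128 + Real.sqrt (1 + (1 / 128) ^ 2))⁻¹ ≤ (1 + 1 / 128 : ℝ)⁻¹ := inv_anti₀ (by norm_num) h2
    have h4 : (1 + 1 / 128 : ℝ)⁻¹ = 128 / 129 := by norm_num
    linarith
  have hexp : Real.arsinh (ω₁ / 4) * L / 2 ≥ 1 := by
    have : Real.arsinh (ω₁ / 4) * L ≥ (1 / 129) * 1024 := mul_le_mul hκ hLr (by norm_num) (le_trans (by norm_num) hκ)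
    linarith
  calc Real.exp (-(Real.arsinh (ω₁ / 4) * L / 2)) ≤ Real.exp (-1) := Real.exp_le_exp.2 (by linarith)
    _ ≤ 1 / 2 := by
        rw [Real.exp_neg, inv_eq_one_div, div_le_div_iff₀ (Real.exp_pos 1) (by norm_num : (0:ℝ) < 2), one_mul, one_mul]
        have := Real.add_one_le_exp (1 : ℝ)
        linarith

/-- **THE SAME CALL WITH THE TWO ELEMENTARY SIDE CONDITIONS DISCHARGED** (`128 ≤ Rc` replaces `√(16+ω₁²) ≤ (Rc+1)ω₁`; `e^{−κ₁L/2} ≤ 1/2` follows from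
`klEngL₃ β U ≤ L`, since `klEngL₃ ≥ 2¹⁰`). -/
theorem sunsetRows_of_certV3_plancherelGaps' [NeZero M] (c : SunsetCellRecordV3) (hc : ScaleZeroSunsetCertV3 c)
    {μ β U : ℝ} (hμlo : (c.μlo : ℝ) ≤ μ) (hμhi : μ ≤ c.μhi)
    (hβ : klBetaMin ≤ β) (hU0 : 0 < U) (hU : U ≤ (2 : ℝ)⁻¹ ^ 20) (hL3 : klEngL₃ β U ≤ L)
    (hδ : β / ((2 * (2 * M) : ℕ) : ℝ) ≤ (2 : ℝ)⁻¹ ^ 10)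
    {N' R : ℕ} (hN' : 2 * 2 ≤ N') (hR : R + 1 + 2 * c.Rc ≤ L)
    (hT : ENNReal.ofReal (β / klBetaMin) *
        ENNReal.ofReal ((19 / 3) * (4 + |μ| + (0 : TrigPolyC4v).coeffNorm 0) * β / (2 * π ^ 2 * M) +
            (N' ! * klChi2CauchyTab N' * (N' + 1) ! * 4 * (max 1 (4 / klE0)) ^ (N' - 1) * ((2 * π) * 4) ^ N') * (2 / klE0) *
              (1 / (2 * Real.pi) ^ N' * (2 / ((2 * R + 2 : ℕ) : ℝ)) ^ (N' - 2 * 2) * (2 ^ 2 * ∑' k : Site 2, ∏ j, (1 + (k j : ℝ) ^ 2)⁻¹))) ≤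
      ENNReal.ofReal (c.Tmax : ℝ))
    (hrow : ∀ k : Fin 3, 0 ≤ (c.row k : ℝ))
    {ω₁ : ℝ} (hω₁ : klE0 ≤ ω₁) (hRc : 128 ≤ c.Rc)
    {G₀ G₂ : ℝ}
    (hgap0 : ∀ i : MatsubaraIdx M, |matsubaraFreq β M i| < ω₁ →
      (∫ y in Torus.unitCube (Fin 2), ‖(fun y : Momentum => uvSymbolFn 1 klE0 (frameLevel μ 0 ((2 * π) • y)) (matsubaraFreq β M i)) y‖ ^ 2) -
        ∑ z ∈ insert (0 : Site 2) c.disk, ‖mFourierCoeff (Torus.descend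
          (fun y : Momentum => uvSymbolFn 1 klE0 (frameLevel μ 0 ((2 * π) • y)) (matsubaraFreq β M i))
          (uvSpatialSymbol_isLatticePeriodic 1 klE0 μ 0 (matsubaraFreq β M i))) (-z)‖ ^ 2 ≤ G₀)
    (hgap2 : ∀ i : MatsubaraIdx M, |matsubaraFreq β M i| < ω₁ →
      (2 * π) ^ (-(2 : ℤ)) *
        ((∫ y in Torus.unitCube (Fin 2), ‖fderiv ℝ (fun y : Momentum => uvSymbolFn 1 klE0 (frameLevel μ 0 ((2 * π) • y)) (matsubaraFreq β M i)) y
            (EuclideanSpace.single 0 (1 : ℝ))‖ ^ 2) +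
          ∫ y in Torus.unitCube (Fin 2), ‖fderiv ℝ (fun y : Momentum => uvSymbolFn 1 klE0 (frameLevel μ 0 ((2 * π) • y)) (matsubaraFreq β M i)) y
            (EuclideanSpace.single 1 (1 : ℝ))‖ ^ 2) -
        ∑ z ∈ insert (0 : Site 2) c.disk, ((((z 0 : ℤ) : ℝ)) ^ 2 + (((z 1 : ℤ) : ℝ)) ^ 2) *
          ‖mFourierCoeff (Torus.descend (fun y : Momentum => uvSymbolFn 1 klE0 (frameLevel μ 0 ((2 * π) • y)) (matsubaraFreq β M i))
            (uvSpatialSymbol_isLatticePeriodic 1 klE0 μ 0 (matsubaraFreq β M i))) (-z)‖ ^ 2 ≤ G₂)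
    {bS : ℕ → ℝ}
    (hbS : ∀ k : Fin 3, (c.row k : ℝ) +
      (50 * Real.exp (-(Real.arsinh (ω₁ / 4) * (c.Rc + 1))) + ω₁ * Real.sqrt ((Real.sqrt (![G₀, Real.sqrt (G₀ * G₂), G₂] 0) + (10 : ℝ)⁻¹ ^ 10) ^ 2)) *
        (2 ^ (k : ℕ) * 2500 *
          ((max 1 ((2 * (k : ℕ) : ℝ) / Real.arsinh (ω₁ / 4))) ^ (k : ℕ) * Real.exp (-(Real.arsinh (ω₁ / 4) * (c.Rc + 1))) *
            (1 + 2 * (1 - Real.exp (-(Real.arsinh (ω₁ / 4) / 4)))⁻¹) ^ 2) / ω₁ +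
          ω₁ * (Real.sqrt (![G₀, Real.sqrt (G₀ * G₂), G₂] k) + (10 : ℝ)⁻¹ ^ 10) ^ 2) ≤ bS k) :
    (∀ (σ : Fin 2) (p₀ : GridPoint L (2 * (2 * M))), ∑ p₁ : GridPoint L (2 * (2 * M)),
      (if p₁ = p₀ then (0 : ℝ) else (if p₁.2 - p₀.2 = 0 then (0 : ℝ) else 1) * ‖contr ℂ ((hubbardGridSub L M β (2 * (2 * M))).transpose * hubbardCovAboveCT L M β μ 0 0 klE0 *
                hubbardGridSub L M β (2 * (2 * M))) (((p₁, σ), 0) : GridLeg (GridPoint L (2 * (2 * M)))) ((p₀, σ), 1) *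
              (contr ℂ ((hubbardGridSub L M β (2 * (2 * M))).transpose * hubbardCovAboveCT L M β μ 0 0 klE0 *
                hubbardGridSub L M β (2 * (2 * M))) (((p₀, σ.rev), 0) : GridLeg (GridPoint L (2 * (2 * M)))) ((p₁, σ.rev), 1) *
                contr ℂ ((hubbardGridSub L M β (2 * (2 * M))).transpose * hubbardCovAboveCT L M β μ 0 0 klE0 *
                hubbardGridSub L M β (2 * (2 * M))) (((p₁, σ.rev), 0) : GridLeg (GridPoint L (2 * (2 * M)))) ((p₀, σ.rev), 1))‖) ≤ bS 0 * (((2 * (2 * M) : ℕ) : ℝ) / β)) ∧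
    (∀ k, 1 ≤ k → k ≤ 2 → ∀ (σ : Fin 2) (p₀ : GridPoint L (2 * (2 * M))), ∑ p₁ : GridPoint L (2 * (2 * M)),
      (if p₁ = p₀ then (0 : ℝ) else
        Real.sqrt ((((p₁.2 - p₀.2) 0).valMinAbs.natAbs : ℝ) ^ 2 + (((p₁.2 - p₀.2) 1).valMinAbs.natAbs : ℝ) ^ 2) ^ k * ‖contr ℂ ((hubbardGridSub L M β (2 * (2 * M))).transpose * hubbardCovAboveCT L M β μ 0 0 klE0 *
                hubbardGridSub L M β (2 * (2 * M))) (((p₁, σ), 0) : GridLeg (GridPoint L (2 * (2 * M)))) ((p₀, σ), 1) *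
              (contr ℂ ((hubbardGridSub L M β (2 * (2 * M))).transpose * hubbardCovAboveCT L M β μ 0 0 klE0 *
                hubbardGridSub L M β (2 * (2 * M))) (((p₀, σ.rev), 0) : GridLeg (GridPoint L (2 * (2 * M)))) ((p₁, σ.rev), 1) *
                contr ℂ ((hubbardGridSub L M β (2 * (2 * M))).transpose * hubbardCovAboveCT L M β μ 0 0 klE0 *
                hubbardGridSub L M β (2 * (2 * M))) (((p₁, σ.rev), 0) : GridLeg (GridPoint L (2 * (2 * M)))) ((p₀, σ.rev), 1))‖) ≤
        bS k * (((2 * (2 * M) : ℕ) : ℝ) / β)) := by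
  have hR' := sqrt_sixteen_add_sq_le_of_klE0_le hω₁ hRc
  have h210 : 2 ^ 10 ≤ L := by
    refine le_trans ?_ hL3
    unfold klEngL₃
    have h1 : 1 ≤ (⌈|β|⌉₊ + 1) ^ 2 := Nat.one_le_pow _ _ (Nat.succ_pos _)
    have h2 : 1 ≤ (⌈|U|⁻¹⌉₊ + 1) ^ 2 := Nat.one_le_pow _ _ (Nat.succ_pos _)
    calc 2 ^ 10 = 2 ^ 10 * 1 * 1 := by norm_num
      _ ≤ 2 ^ 10 * (⌈|β|⌉₊ + 1) ^ 2 * (⌈|U|⁻¹⌉₊ + 1) ^ 2 := Nat.mul_le_mul (Nat.mul_le_mul_left _ h1) h2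
  have hρ := exp_neg_arsinh_mul_le_half_of_le (L := L) hω₁ h210
  exact sunsetRows_of_certV3_plancherelGaps (L := L) c hc hμlo hμhi hβ hU0 hU hL3 hδ hN' hR hT hrow hω₁ hρ hR' hgap0 hgap2 hbS

end Summit.HubbardSuperconductivity.HubbardSuperconductivity.Theorems.KLRegimeSplit

end
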